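import Mathlib.Analysis.SpecialFunctions.Pow.Real
import Mathlib.Analysis.SpecialFunctions.Log.Basic
import Mathlib.Analysis.SpecialFunctions.Sqrt
import HarnessLib

/-!
# ζ(5) search — growth bounds from a quadratic LYAPUNOV certificate (cell `pub-zeta5`, PROVER 3)

HONEST FRAMING: systematic search; no irrationality claim unless certified.

WHY. FORMAT A (`ApproximationCertificate`) needs an UPPER bound `|W_n| ≤ K e^{w n}` for the Casoratian
`W_n = u_n v_{n+1} − u_{n+1} v_n` of the two solutions (field `casorati_le`) and growth bounds for `u_n`.
For an ORDER-2 recurrence `W_n` is a closed product (Abel); for ORDER 3 the typer's tools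
(`RecurrenceGrowthOrderThree`: `casoratian3_rec` + ratio boxes) give `W`'s own order-3 recurrence and boxes
for the three MONOTONE sign patterns — but when the relevant characteristic roots are a COMPLEX-CONJUGATE pair
(every family of the measure lane: Rhin–Viola, Zudilin 2014, Marcovecchio–Zudilin; `families/measure/FAMILY.md`
§0) no interval of ratios is invariant and Poincaré–Perron gives no limit of ratios. An upper bound of the
right exponential order nevertheless holds for EVERY solution of a linear system whose coefficient maps are
uniformly contracting for some quadratic gauge — a discrete LYAPUNOV function — and checking that is a finite
family of polynomial inequalities in `n`, i.e. kernel-checkable in the cell's style (`PolyPositivity.lean`).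
This file is that tool, stated abstractly (no matrices needed):

* `gauge_le_pow` — if `x (n+1) = T n (x n)` and `Q (T n v) ≤ ρ² · Q v` for all `v` and all `n ≥ N`, then
  `Q (x n) ≤ (ρ²)^{n−N} Q (x N)` (`Q` any real "gauge", `T n` any maps — linearity is not used);
* `abs_coord_le` — with a coercivity constant `κ (v i)² ≤ Q v`: `|x n i| ≤ √(Q(x N)/κ) · ρ^{n−N}`;
* `companion3`, `companion3_traj` — the order-3 scalar recurrence `y(n+3) = a n y(n+2) + b n y(n+1) + c n y n`
  as a trajectory of maps on `Fin 3 → ℝ`;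
* `abs_le_exp_of_lyapunov3` — **the certificate**: a scalar order-3 recurrence for `W` (e.g. the Casoratian
  recurrence `casoratian3_rec`, whose roots are the pairwise products `μ_iμ_j`), a quadratic gauge `Q` on `ℝ³`
  with coercivity `κ > 0` and the one-step contraction `Q (companion3 a b c n v) ≤ ρ² Q v` for `n ≥ N`
  (`ρ > 0`) give `K > 0` with `|W n| ≤ K · e^{(log ρ) n}` for all `n ≥ N` — exactly the shape of
  `ApproximationCertificate.casorati_le` with `w = log ρ`, and of `growth_upper` with `Q' = log ρ`;
* `step_of_sos3` — the discharge pattern for the contraction: an identity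
  `ρ² Q v − Q (T v) = d₁ ℓ₁(v)² + d₂ ℓ₂(v)² + d₃ ℓ₃(v)²` with `dᵢ ≥ 0` (an `LDLᵀ`/SOS decomposition, found
  numerically and written with rational coefficients; for polynomial coefficients in `n` the `dᵢ(n) ≥ 0` are
  `PolyPositivity` facts);
* a worked CONSTANT-COEFFICIENT instance (`toy_bound`): `y(n+3) = y(n+2) − y(n+1)/2` (roots `0, (1±i)/2`,
  modulus `1/√2`) is `O((4/5)^n)` for every real initial data — complex roots, no sign pattern, certified by a
  rational quadratic form and `nlinarith`.

HOW IT CLOSES THE ORDER-3 GAP (design note for the certifiers; nothing below is claimed for any family): for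
forms `u_n ξ − v_n` from an order-3 recurrence with real dominant root `μ₁` and complex subdominant pair
`μ₂, μ₃ = μ̄₂`: (1) `u, v` satisfy the recurrence (telescoping certificate, `Certificates/Telescoping`);
(2) `W` satisfies `casoratian3_rec`, dominant roots `μ₁μ₂, μ₁μ̄₂` of modulus `μ₁|μ₂|` — `abs_le_exp_of_lyapunov3`
with any `ρ > μ₁|μ₂|` gives `casorati_le` (the Casoratian is a RATIONAL sequence: `ξ` cancels, no
stable-manifold problem); (3) growth of `u` two-sided (entropy of a one-signed binomial sum,
`Certificates/BinomialSumBounds`, or Poincaré); (4) `ApproximationCertificate` ⇒ `ξ ∉ ℚ` and, with the LIMIT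
rate of `u` (`MeasureHata.ExponentLE.of_tendsto_log_coeff`), the sharp exponent `1 + (Q + δ)/(−log|μ₂| − δ)`.
Everything here is PROVED (0 sorry); no family data appear.
-/

noncomputable section

open Filter Topology Finset

namespace Summit.KontsevichZagierPeriods.Zeta5Search

namespace Lyapunov

/-! ### Abstract contraction along a trajectory -/

/-- **Gauge contraction.** If `x (n+1) = T n (x n)` and `Q (T n v) ≤ ρ² Q v` for all `v` and `n ≥ N`, then
`Q (x n) ≤ (ρ²)^{n−N} · Q (x N)` for all `n ≥ N`. -/
theorem gauge_le_pow {α : Type*} (Q : α → ℝ) (T : ℕ → α → α) (x : ℕ → α) {ρ : ℝ} {N : ℕ}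
    (hx : ∀ n, N ≤ n → x (n + 1) = T n (x n))
    (hstep : ∀ n, N ≤ n → ∀ v, Q (T n v) ≤ ρ ^ 2 * Q v) :
    ∀ n, N ≤ n → Q (x n) ≤ (ρ ^ 2) ^ (n - N) * Q (x N) := by
  intro n hn
  induction n, hn using Nat.le_induction with
  | base => simp
  | succ m hm ih =>
    rw [hx m hm]
    calc Q (T m (x m)) ≤ ρ ^ 2 * Q (x m) := hstep m hm _
      _ ≤ ρ ^ 2 * ((ρ ^ 2) ^ (m - N) * Q (x N)) := mul_le_mul_of_nonneg_left ih (sq_nonneg ρ)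
      _ = (ρ ^ 2) ^ (m + 1 - N) * Q (x N) := by
        rw [← mul_assoc, ← pow_succ', Nat.succ_sub hm]

/-- **Coordinate bound.** Under a coercivity constant `κ > 0`, `κ (v i)² ≤ Q v` for all `v, i`, the
contraction of `gauge_le_pow` (`ρ ≥ 0`) gives `|x n i| ≤ √(Q (x N)/κ) · ρ^{n−N}` for `n ≥ N`. -/
theorem abs_coord_le {ι : Type*} (Q : (ι → ℝ) → ℝ) (T : ℕ → (ι → ℝ) → (ι → ℝ)) (x : ℕ → ι → ℝ)
    {ρ κ : ℝ} {N : ℕ} (hρ : 0 ≤ ρ) (hκ : 0 < κ) (hcoer : ∀ v i, κ * (v i) ^ 2 ≤ Q v)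
    (hx : ∀ n, N ≤ n → x (n + 1) = T n (x n))
    (hstep : ∀ n, N ≤ n → ∀ v, Q (T n v) ≤ ρ ^ 2 * Q v) :
    ∀ n, N ≤ n → ∀ i, |x n i| ≤ Real.sqrt (Q (x N) / κ) * ρ ^ (n - N) := by
  intro n hn i
  have h1 := gauge_le_pow Q T x hx hstep n hn
  have h2 : (x n i) ^ 2 ≤ (Real.sqrt (Q (x N) / κ) * ρ ^ (n - N)) ^ 2 := by
    have hQN : 0 ≤ Q (x N) := le_trans (by positivity) (hcoer (x N) i)
    have h3 := hcoer (x n) i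
    have e : (Real.sqrt (Q (x N) / κ) * ρ ^ (n - N)) ^ 2 = (ρ ^ 2) ^ (n - N) * Q (x N) / κ := by
      rw [mul_pow, Real.sq_sqrt (div_nonneg hQN hκ.le), ← pow_mul, mul_comm (n - N) 2, pow_mul]
      ring
    rw [e, le_div_iff₀ hκ]
    nlinarith
  have h4 : 0 ≤ Real.sqrt (Q (x N) / κ) * ρ ^ (n - N) := by positivity
  exact abs_le.2 (abs_le_of_sq_le_sq' h2 h4)

/-! ### The order-3 scalar recurrence as a trajectory -/

/-- The companion map of the scalar recurrence `y(n+3) = a n · y(n+2) + b n · y(n+1) + c n · y n` on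
`ℝ³ = (y n, y (n+1), y (n+2))`. -/
def companion3 (a b c : ℕ → ℝ) (n : ℕ) (v : Fin 3 → ℝ) : Fin 3 → ℝ :=
  ![v 1, v 2, a n * v 2 + b n * v 1 + c n * v 0]

/-- The window `(y n, y (n+1), y (n+2))` of a solution is a trajectory of `companion3`. -/
theorem companion3_traj (y a b c : ℕ → ℝ) {N : ℕ}
    (hy : ∀ n, N ≤ n → y (n + 3) = a n * y (n + 2) + b n * y (n + 1) + c n * y n) :
    ∀ n, N ≤ n → (![y (n + 1), y (n + 1 + 1), y (n + 1 + 2)] : Fin 3 → ℝ) =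
      companion3 a b c n ![y n, y (n + 1), y (n + 2)] := by
  intro n hn
  ext i
  fin_cases i
  · simp [companion3]
  · simp [companion3]
  · simp [companion3, hy n hn]

/-- **SOS discharge of the one-step contraction** (any map `T`, any gauge `Q`): an identity
`ρ² Q v − Q (T v) = d₁ ℓ₁² + d₂ ℓ₂² + d₃ ℓ₃²` with `dᵢ ≥ 0` gives `Q (T v) ≤ ρ² Q v`. -/
theorem step_of_sos3 {α : Type*} {Q : α → ℝ} {T : α → α} {ρ : ℝ} {v : α}
    (d₁ d₂ d₃ ℓ₁ ℓ₂ ℓ₃ : ℝ) (hd₁ : 0 ≤ d₁) (hd₂ : 0 ≤ d₂) (hd₃ : 0 ≤ d₃)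
    (hid : ρ ^ 2 * Q v - Q (T v) = d₁ * ℓ₁ ^ 2 + d₂ * ℓ₂ ^ 2 + d₃ * ℓ₃ ^ 2) :
    Q (T v) ≤ ρ ^ 2 * Q v := by
  nlinarith [sq_nonneg ℓ₁, sq_nonneg ℓ₂, sq_nonneg ℓ₃]

/-- **The Lyapunov certificate for an order-3 scalar recurrence.** If `W (n+3) = a n W(n+2) + b n W(n+1) +
c n W n` for `n ≥ N`, and a gauge `Q : (Fin 3 → ℝ) → ℝ` is coercive (`κ (v i)² ≤ Q v`, `κ > 0`) and
contracted by the companion maps (`Q (companion3 a b c n v) ≤ ρ² Q v` for `n ≥ N`, `ρ > 0`), then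
`|W n| ≤ K · e^{(log ρ) n}` for all `n ≥ N`, for some `K > 0` — the shape of
`ApproximationCertificate.casorati_le` (`w = log ρ`) and `growth_upper` (`Q' = log ρ`). -/
theorem abs_le_exp_of_lyapunov3 (W a b c : ℕ → ℝ) {N : ℕ}
    (hW : ∀ n, N ≤ n → W (n + 3) = a n * W (n + 2) + b n * W (n + 1) + c n * W n)
    (Q : (Fin 3 → ℝ) → ℝ) {κ ρ : ℝ} (hκ : 0 < κ) (hρ : 0 < ρ)
    (hcoer : ∀ v i, κ * (v i) ^ 2 ≤ Q v)
    (hstep : ∀ n, N ≤ n → ∀ v, Q (companion3 a b c n v) ≤ ρ ^ 2 * Q v) :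
    ∃ K : ℝ, 0 < K ∧ ∀ n, N ≤ n → |W n| ≤ K * Real.exp (Real.log ρ * n) := by
  set x : ℕ → Fin 3 → ℝ := fun n => ![W n, W (n + 1), W (n + 2)] with hxdef
  have hx : ∀ n, N ≤ n → x (n + 1) = companion3 a b c n (x n) := fun n hn => by
    simp only [hxdef]
    have := companion3_traj W a b c hW n hn
    simpa [add_assoc] using this
  have hb := abs_coord_le Q (companion3 a b c) x hρ.le hκ hcoer hx hstep
  refine ⟨Real.sqrt (Q (x N) / κ) * ρ ^ (-(N : ℤ)) + 1, by positivity, fun n hn => ?_⟩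
  have h1 := hb n hn 0
  have hx0 : x n 0 = W n := by simp [hxdef]
  rw [hx0] at h1
  have hexp : Real.exp (Real.log ρ * n) = ρ ^ n := by
    rw [mul_comm, Real.exp_nat_mul, Real.exp_log hρ]
  rw [hexp]
  have hpow : ρ ^ (n - N) = ρ ^ (-(N : ℤ)) * ρ ^ n := by
    rw [← zpow_natCast, Nat.cast_sub hn, zpow_sub₀ hρ.ne', zpow_natCast, zpow_natCast, div_eq_mul_inv,
      zpow_neg, zpow_natCast, mul_comm]
  rw [hpow, ← mul_assoc] at h1
  refine h1.trans ?_
  have : 0 ≤ ρ ^ n := pow_nonneg hρ.le n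
  nlinarith

/-- Eventual form: `∀ᶠ n, |W n| ≤ K e^{(log ρ) n}`. -/
theorem eventually_abs_le_exp_of_lyapunov3 (W a b c : ℕ → ℝ) {N : ℕ}
    (hW : ∀ n, N ≤ n → W (n + 3) = a n * W (n + 2) + b n * W (n + 1) + c n * W n)
    (Q : (Fin 3 → ℝ) → ℝ) {κ ρ : ℝ} (hκ : 0 < κ) (hρ : 0 < ρ)
    (hcoer : ∀ v i, κ * (v i) ^ 2 ≤ Q v)
    (hstep : ∀ n, N ≤ n → ∀ v, Q (companion3 a b c n v) ≤ ρ ^ 2 * Q v) :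
    ∃ K : ℝ, 0 < K ∧ ∀ᶠ n : ℕ in atTop, |W n| ≤ K * Real.exp (Real.log ρ * n) := by
  obtain ⟨K, hK, h⟩ := abs_le_exp_of_lyapunov3 W a b c hW Q hκ hρ hcoer hstep
  exact ⟨K, hK, eventually_atTop.2 ⟨N, h⟩⟩

/-! ### A worked constant-coefficient instance (complex roots, no sign pattern) -/

/-- TOY INSTANCE of the certificate: every real solution of `y(n+3) = y(n+2) − y(n+1)/2` (characteristic roots
`0, (1 ± i)/2`, of modulus `1/√2 = 0.707…`; the solutions OSCILLATE, no ratio interval is invariant) satisfies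
`|y n| ≤ K (4/5)^n`. Gauge `Q(v) = v₀² + (25/2)v₁² − 22 v₁v₂ + (101/4)v₂²` (a rounded solution of the discrete
Lyapunov equation for `A/ρ`, `ρ = 4/5`), coercivity `κ = 1/2`, contraction and coercivity discharged by the
exact SOS identities `ρ²Q(v) − Q(Av) = (16/25)v₀² + (11/16)(v₁ + (34/275)v₂)² + (5493/13750)v₂²` and
`Q(v) − ½|v|² = ½v₀² + 12(v₁ − (11/12)v₂)² + (44/3)v₂²` (p3 `work/lyap/toy.py`). -/
theorem toy_bound (y : ℕ → ℝ)
    (hy : ∀ n, 0 ≤ n → y (n + 3) = 1 * y (n + 2) + (-1 / 2) * y (n + 1) + 0 * y n) :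
    ∃ K : ℝ, 0 < K ∧ ∀ n, 0 ≤ n → |y n| ≤ K * Real.exp (Real.log (4 / 5) * n) := by
  refine abs_le_exp_of_lyapunov3 y (fun _ => 1) (fun _ => -1 / 2) (fun _ => 0) hy
    (fun v => v 0 ^ 2 + 25 / 2 * v 1 ^ 2 - 22 * v 1 * v 2 + 101 / 4 * v 2 ^ 2) (κ := 1 / 2) (ρ := 4 / 5)
    (by norm_num) (by norm_num) ?_ ?_
  · intro v i
    have hsos : (v 0 ^ 2 + 25 / 2 * v 1 ^ 2 - 22 * v 1 * v 2 + 101 / 4 * v 2 ^ 2) -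
        1 / 2 * (v 0 ^ 2 + v 1 ^ 2 + v 2 ^ 2) =
        1 / 2 * v 0 ^ 2 + 12 * (v 1 - 11 / 12 * v 2) ^ 2 + 44 / 3 * v 2 ^ 2 := by ring
    have hi : v i ^ 2 ≤ v 0 ^ 2 + v 1 ^ 2 + v 2 ^ 2 := by
      have h := Finset.single_le_sum (f := fun j : Fin 3 => v j ^ 2) (fun j _ => sq_nonneg (v j))
        (Finset.mem_univ i)
      simpa [Fin.sum_univ_three] using h
    nlinarith [hsos, hi, sq_nonneg (v 0), sq_nonneg (v 2), sq_nonneg (v 1 - 11 / 12 * v 2)]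
  · intro n _ v
    have hT0 : companion3 (fun _ => (1 : ℝ)) (fun _ => -1 / 2) (fun _ => 0) n v 0 = v 1 := by
      simp [companion3]
    have hT1 : companion3 (fun _ => (1 : ℝ)) (fun _ => -1 / 2) (fun _ => 0) n v 1 = v 2 := by
      simp [companion3]
    have hT2 : companion3 (fun _ => (1 : ℝ)) (fun _ => -1 / 2) (fun _ => 0) n v 2 =
        1 * v 2 + (-1 / 2) * v 1 + 0 * v 0 := by
      simp [companion3]
    rw [hT0, hT1, hT2]
    -- `ρ²Q(v) − Q(Av) = (16/25)v₀² + (11/16)(v₁ + (34/275)v₂)² + (5493/13750)v₂²`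
    nlinarith [sq_nonneg (v 0), sq_nonneg (v 1 + 34 / 275 * v 2), sq_nonneg (v 2)]


/-! ### A worked instance with POLYNOMIAL (n-dependent) coefficients (appended by p3, 2026-08-20)

The recipe of the module docstring, step (iii), on a recurrence whose coefficients vary with `n`: the one-step
contraction `Q(Aₙv) ≤ ρ²Q(v)` for ALL `n ≥ N` is certified by the FRACTION-FREE completion of squares of the
polynomial matrix `M̃(n) = dₙ²(ρ²P − AₙᵀPAₙ)` (`dₙ` the common denominator of the coefficients):
`m₁₁·D₂·vᵀM̃v = D₂(m₁₁v₀ + m₁₂v₁ + m₁₃v₂)² + (D₂v₁ + Ev₂)² + m₁₁·det(M̃)·v₂²` (`D₂` the leading 2×2 minor,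
`E = m₁₁m₂₃ − m₁₂m₁₃`), so PSD-ness for `n ≥ N` is the positivity of the three polynomials `m₁₁, D₂, det M̃` on
`n ≥ N`, written with non-negative coefficients in `m = n − N` (Taylor shift, as in `PolyPositivity.lean`).
Generator: `HOME/lean/p3/poly_toy.py` (exact rational arithmetic; identity re-checked on random inputs). -/

/-- TOY INSTANCE with polynomial coefficients: every real solution of
`y(n+3) = (n+3)/(n+2)·y(n+2) − (n+1)/(2(n+2))·y(n+1) + y(n)/(10(n+2))` (limit roots `0, (1±i)/2`) satisfies
`|y n| ≤ K·(9/10)^n` for `n ≥ 6`: same gauge `Q` as `toy_bound`, `ρ = 9/10`, `N = 6`; the contraction for all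
`n ≥ 6` is ONE polynomial SOS identity in `(m, v)` (`m = n − 6`) with the three Taylor-shifted minors
`m₁₁ = 4127/80 + 324/25·m + 81/100·m²`, `D₂ = 704617/50 + …`, `det = 891393858/3125 + …` visibly positive. -/
theorem toy_poly_bound (y : ℕ → ℝ)
    (hy : ∀ n, 6 ≤ n → y (n + 3) = ((n : ℝ) + 3) / ((n : ℝ) + 2) * y (n + 2) +
      -((n : ℝ) + 1) / (2 * ((n : ℝ) + 2)) * y (n + 1) + 1 / (10 * ((n : ℝ) + 2)) * y n) :
    ∃ K : ℝ, 0 < K ∧ ∀ n, 6 ≤ n → |y n| ≤ K * Real.exp (Real.log (9 / 10) * n) := by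
  refine abs_le_exp_of_lyapunov3 y (fun n => ((n : ℝ) + 3) / ((n : ℝ) + 2))
    (fun n => -((n : ℝ) + 1) / (2 * ((n : ℝ) + 2))) (fun n => 1 / (10 * ((n : ℝ) + 2))) hy
    (fun v => v 0 ^ 2 + 25 / 2 * v 1 ^ 2 - 22 * v 1 * v 2 + 101 / 4 * v 2 ^ 2) (κ := 1 / 2) (ρ := 9 / 10)
    (by norm_num) (by norm_num) ?_ ?_
  · intro v i
    have hsos : (v 0 ^ 2 + 25 / 2 * v 1 ^ 2 - 22 * v 1 * v 2 + 101 / 4 * v 2 ^ 2) -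
        1 / 2 * (v 0 ^ 2 + v 1 ^ 2 + v 2 ^ 2) =
        1 / 2 * v 0 ^ 2 + 12 * (v 1 - 11 / 12 * v 2) ^ 2 + 44 / 3 * v 2 ^ 2 := by ring
    have hi : v i ^ 2 ≤ v 0 ^ 2 + v 1 ^ 2 + v 2 ^ 2 := by
      have h := Finset.single_le_sum (f := fun j : Fin 3 => v j ^ 2) (fun j _ => sq_nonneg (v j))
        (Finset.mem_univ i)
      simpa [Fin.sum_univ_three] using h
    nlinarith [hsos, hi, sq_nonneg (v 0), sq_nonneg (v 2), sq_nonneg (v 1 - 11 / 12 * v 2)]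
  · intro n hn v
    have hT0 : companion3 (fun n => ((n : ℝ) + 3) / ((n : ℝ) + 2)) (fun n => -((n : ℝ) + 1) / (2 * ((n : ℝ) + 2)))
        (fun n => 1 / (10 * ((n : ℝ) + 2))) n v 0 = v 1 := by
      simp [companion3]
    have hT1 : companion3 (fun n => ((n : ℝ) + 3) / ((n : ℝ) + 2)) (fun n => -((n : ℝ) + 1) / (2 * ((n : ℝ) + 2)))
        (fun n => 1 / (10 * ((n : ℝ) + 2))) n v 1 = v 2 := by
      simp [companion3]
    have hT2 : companion3 (fun n => ((n : ℝ) + 3) / ((n : ℝ) + 2)) (fun n => -((n : ℝ) + 1) / (2 * ((n : ℝ) + 2)))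
        (fun n => 1 / (10 * ((n : ℝ) + 2))) n v 2 =
        ((n : ℝ) + 3) / ((n : ℝ) + 2) * v 2 + -((n : ℝ) + 1) / (2 * ((n : ℝ) + 2)) * v 1 +
          1 / (10 * ((n : ℝ) + 2)) * v 0 := by
      simp [companion3]
    rw [hT0, hT1, hT2]
    obtain ⟨m, rfl⟩ : ∃ m : ℕ, n = m + 6 := ⟨n - 6, by omega⟩
    push_cast
    set x : ℝ := (m : ℝ) with hx
    have hx0 : 0 ≤ x := by rw [hx]; positivity
    set W : ℝ := (x + 6 + 3) / (x + 6 + 2) * v 2 + -(x + 6 + 1) / (2 * (x + 6 + 2)) * v 1 +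
      1 / (10 * (x + 6 + 2)) * v 0 with hW
    -- the Taylor-shifted (at N = 6) entries and minors of `M̃(n) = (n+2)²(ρ²P − AₙᵀPAₙ)`
    set M11 : ℝ := 4127 / 80 + 324 / 25 * x + 81 / 100 * x ^ 2 with hM11
    set M12 : ℝ := 707 / 80 + 101 / 80 * x with hM12
    set M13 : ℝ := -557 / 40 - 57 / 40 * x with hM13
    set DD : ℝ := 704617 / 50 + 1302073 / 200 * x + 3561001 / 3200 * x ^ 2 + 66501 / 800 * x ^ 3 +
      729 / 320 * x ^ 4 with hDD
    set EE : ℝ := -518967 / 125 - 5583411 / 2500 * x - 3650103 / 8000 * x ^ 2 - 209061 / 5000 * x ^ 3 -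
      28917 / 20000 * x ^ 4 with hEE
    set DET : ℝ := 891393858 / 3125 + 10495964781 / 15625 * x + 81152504559 / 250000 * x ^ 2 +
      68487784533 / 1000000 * x ^ 3 + 234434681253 / 32000000 * x ^ 4 + 3115237401 / 8000000 * x ^ 5 +
      130112649 / 16000000 * x ^ 6 with hDET
    have hM11pos : 0 < M11 := by rw [hM11]; positivity
    have hDDpos : 0 < DD := by rw [hDD]; positivity
    have hDETnn : 0 ≤ DET := by rw [hDET]; positivity
    have hd : 0 < x + 6 + 2 := by positivity
    have key : (x + 6 + 2) ^ 2 * M11 * DD *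
        ((9 / 10) ^ 2 * (v 0 ^ 2 + 25 / 2 * v 1 ^ 2 - 22 * v 1 * v 2 + 101 / 4 * v 2 ^ 2) -
          (v 1 ^ 2 + 25 / 2 * v 2 ^ 2 - 22 * v 2 * W + 101 / 4 * W ^ 2)) =
        DD * (M11 * v 0 + M12 * v 1 + M13 * v 2) ^ 2 + (DD * v 1 + EE * v 2) ^ 2 +
          M11 * DET * v 2 ^ 2 := by
      rw [hW, hM11, hM12, hM13, hDD, hEE, hDET]
      field_simp
      ring
    have hrhs : 0 ≤ DD * (M11 * v 0 + M12 * v 1 + M13 * v 2) ^ 2 + (DD * v 1 + EE * v 2) ^ 2 +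
        M11 * DET * v 2 ^ 2 := by positivity
    have hprod : 0 < (x + 6 + 2) ^ 2 * M11 * DD := by positivity
    rw [← key] at hrhs
    exact sub_nonneg.1 ((mul_nonneg_iff_of_pos_left hprod).1 hrhs)

end Lyapunov

end Summit.KontsevichZagierPeriods.Zeta5Search
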